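import Summits.ResolutionOfSingularities.ResolutionOfSingularities.Theorems.DescentDescentPerfectToAllPerfectBase
import HarnessLib

/-!
# `DescentPerfectToAll` (stmt-ResolutionOfSingularities-0549) holds over every ground field SEPARABLY GENERATED
# over a perfect subfield (any transcendence degree)

Route `ResolutionOfSingularities/Descent`, crux `DescentPerfectToAll`. Helper (OURS; not a statement of any
manuscript; `--supports` the crux, does not close it).

The perfect-core layer (`DescentDescentPerfectToAllPerfectBase.lean`, `…PerfectCore.lean`,
`…PerfectCoreResidual.lean`) computes the master
class of `hasResolution_of_perfectRes_of_exhaustedByEssFiniteType` on fields of FINITE transcendence degree over a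
perfect subfield (`p`-rank `=` transcendence degree). This file treats arbitrary transcendence degree: the
classical notion is Mac Lane's SEPARATING TRANSCENDENCE BASIS — a (possibly infinite) family `B`, algebraically
independent over the perfect subfield `P`, with `K` separable algebraic over `P(B)`. Such fields are
EFT-separably exhausted, so the crux's conclusion holds over them (given its antecedent `PerfectRes p`):

* `linearIndepOn_pow_of_isSeparable_tower` — **Mac Lane's condition climbs separable algebraic towers**: if
  `F ≤ E ≤ K`, every element of `E` is separable algebraic over `F`, and `K / F` satisfies Mac Lane's condition
  (`F`-free finite families have `F`-free `p`-th powers), then so does `K / E` (a finite separable extension is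
  spanned by `p`-th powers, Mathlib's `Field.span_map_pow_expChar_pow_eq_top_of_isSeparable`).
* `isSeparable_closure_of_isSeparable_adjoin` — finiteness: an element separable algebraic over `P(B)` is
  separable algebraic over `P(T)` for a finite `T ⊆ B` (coefficients of the minimal polynomial).
* `exhaustedByEssFiniteType_of_separatingTranscendenceBasis` — **separably generated over a perfect subfield ⇒
  EFT-separably exhausted**: `P ≤ K` perfect, `B ⊆ K` with all finite subfamilies `p`-independent in `K`
  (equivalently, by `algebraicIndependent_of_pIndependent_perfect`, algebraically independent over `P` and
  `p`-independent), `K / P(B)` separable algebraic; for a finite `s` the level is `E = P(T)(s)` with `T ⊆ B` finite,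
  and Mac Lane for `K / E` comes from the digit expansion in `P(T)` (`linearIndepOn_pow_closure_perfect_range`)
  climbed along the separable step `P(T)(s) / P(T)`.
* `hasResolution_of_perfectRes_of_separatingTranscendenceBasis`, `descentPerfectToAll_separablyGeneratedPerfect`
  — **resolution over perfect fields ⇒ resolution over every field separably generated over a perfect subfield**
  (all dimensions; e.g. separable algebraic extensions of `𝔽_p(u^{1/p^∞})(t₁, t₂, …)`).

What is NOT separably generated over its perfect core: `𝔽_p((t))` and its countable `𝔽_p(t, u)`-hulls
(`not_exhaustedByEssFiniteType_laurentSeries`, `exists_countable_field_not_exhaustedByEssFiniteType`) — the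
residual class of the crux.

[cite: Matsumura1987, §26 Thm. 26.5–26.8; EGAIV2, Prop. 6.7.4] [folklore]
-/

noncomputable section

set_option linter.dupNamespace false -- mandated namespace of this single-conjunct summit

open CategoryTheory CategoryTheory.Limits AlgebraicGeometry
open Literature.AlgebraicGeometry.Resolution

namespace Summit.ResolutionOfSingularities.ResolutionOfSingularities.Theorems

variable {p : ℕ} [Fact p.Prime] {K : Type} [Field K] [CharP K p]

/-! ## Mac Lane's condition climbs separable algebraic towers -/

variable (p) in
/-- **Mac Lane's condition climbs a separable algebraic step.** Let `F ≤ E ≤ K` be subfields with every element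
of `E` separable algebraic over `F`, and suppose `F`-linearly independent finite families in `K` have
`F`-linearly independent `p`-th powers. Then `E`-linearly independent finite families in `K` have `E`-linearly
independent `p`-th powers: write the coefficients `cⱼ ∈ E` of a relation `∑ cⱼ uⱼ^p = 0` in the finite separable
extension `L = F(c) ≤ E`, which is `F`-spanned by the `p`-th powers `b_k^p` of an `F`-basis `b_k`
(`Field.span_map_pow_expChar_pow_eq_top_of_isSeparable`); the family `b_k uⱼ` is `F`-free, hence so is
`(b_k uⱼ)^p`, and all coordinates vanish. [cite: Matsumura1987, Thm. 26.4; EGAIV2, Prop. 6.7.4] -/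
theorem linearIndepOn_pow_of_isSeparable_tower (F E : Subfield K) (hFE : F ≤ E)
    (hsep : ∀ y ∈ E, IsSeparable F y)
    (hML : ∀ u : Finset K, LinearIndepOn F _root_.id (↑u : Set K) →
      LinearIndepOn F (fun x : K => x ^ p) (↑u : Set K))
    (u : Finset K) (hu : LinearIndepOn E _root_.id (↑u : Set K)) :
    LinearIndepOn E (fun x : K => x ^ p) (↑u : Set K) := by
  classical
  have hp : p.Prime := Fact.out
  haveI : CharP F p := F.subtype.charP Subtype.val_injective p
  haveI : ExpChar F p := ExpChar.prime hp
  haveI : ExpChar K p := ExpChar.prime hp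
  -- Mac Lane for `K / F` in family form
  have H' : ∀ (ι : Type) [Fintype ι] (v : ι → K), LinearIndependent F v →
      LinearIndependent F (fun i => v i ^ p) := by
    intro ι _ v hv
    have h := hML (Finset.univ.image v) (by simpa using hv.linearIndepOn_id)
    simpa only [Finset.coe_image, Finset.coe_univ, Set.image_univ,
      linearIndepOn_range_iff hv.injective, Function.comp_def] using h
  rw [LinearIndepOn, Fintype.linearIndependent_iff] at hu ⊢
  intro c hc
  -- the finite separable extension `L = F(c_j : j) ≤ E`
  set C : Finset K := Finset.univ.image (fun j : ↥(↑u : Set K) => (c j : K)) with hCdef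
  have hCE : (↑C : Set K) ⊆ E := by
    intro x hx
    rw [hCdef, Finset.coe_image] at hx
    obtain ⟨j, -, rfl⟩ := hx
    exact (c j).2
  set L : IntermediateField F K := IntermediateField.adjoin F (↑C : Set K) with hLdef
  have hCsep : ∀ x ∈ (↑C : Set K), IsSeparable F x := fun x hx => hsep x (hCE hx)
  haveI : Finite (↑C : Set K) := C.finite_toSet.to_subtype
  haveI : FiniteDimensional F L :=
    IntermediateField.finiteDimensional_adjoin fun x hx => (hCsep x hx).isIntegral
  haveI : Algebra.IsSeparable F L :=
    (IntermediateField.isSeparable_adjoin_iff_isSeparable F K).mpr hCsep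
  have hLE : ∀ z : L, (z : K) ∈ E := by
    intro z
    have hz : (z : K) ∈ (IntermediateField.adjoin F (↑C : Set K)).toSubfield := z.2
    rw [IntermediateField.adjoin_toSubfield] at hz
    refine (Subfield.closure_le.mpr ?_) hz
    rintro x (⟨y, rfl⟩ | hx)
    · exact hFE y.2
    · exact hCE hx
  -- an `F`-basis `b` of `L`; its `p`-th powers span `L`
  let b := Module.finBasis F L
  set d := Module.finrank F L with hd
  have hspan : Submodule.span F (Set.range fun k : Fin d => (b k : L) ^ p) = ⊤ := by
    have h := Field.span_map_pow_expChar_pow_eq_top_of_isSeparable (F := F) (E := L) p 1 (v := ⇑b)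
      b.span_eq
    simpa only [pow_one] using h
  -- coordinates of the `c_j` along the `b_k ^ p`
  have hcoord : ∀ j, ∃ g : Fin d → F, (c j : K) = ∑ k, ((g k : F) : K) * ((b k : L) : K) ^ p := by
    intro j
    have hcj : (c j : K) ∈ L := IntermediateField.subset_adjoin F _ (by
      rw [hCdef, Finset.coe_image]
      exact ⟨j, Finset.mem_coe.mpr (Finset.mem_univ j), rfl⟩)
    have hmem : (⟨c j, hcj⟩ : L) ∈ Submodule.span F (Set.range fun k : Fin d => (b k : L) ^ p) := by
      rw [hspan]; exact Submodule.mem_top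
    obtain ⟨g, hg⟩ := (Submodule.mem_span_range_iff_exists_fun F).mp hmem
    refine ⟨g, ?_⟩
    have h := congrArg (fun z : L => (z : K)) hg
    simp only [AddSubmonoidClass.coe_finsetSum, IntermediateField.coe_smul, SubmonoidClass.coe_pow] at h
    rw [← h]
    refine Finset.sum_congr rfl fun k _ => ?_
    rw [Subfield.smul_def, smul_eq_mul]
  choose g hg using hcoord
  -- the family `(k, j) ↦ b_k * u_j` is `F`-free
  have hv : LinearIndependent F
      (fun kj : Fin d × ↥(↑u : Set K) => ((b kj.1 : L) : K) * (kj.2 : K)) := by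
    rw [Fintype.linearIndependent_iff]
    intro a ha kj
    -- regroup the relation along the `u_j`, with coefficients in `E`
    have hmemE : ∀ j : ↥(↑u : Set K), ∑ k, ((a (k, j) : F) : K) * ((b k : L) : K) ∈ E :=
      fun j => sum_mem fun k _ => mul_mem (hFE (a (k, j)).2) (hLE (b k))
    have hrel : ∑ j, (⟨_, hmemE j⟩ : E) • _root_.id (j : K) = 0 := by
      rw [← ha, Fintype.sum_prod_type, Finset.sum_comm]
      refine Finset.sum_congr rfl fun j _ => ?_
      rw [Subfield.smul_def, smul_eq_mul, _root_.id, Finset.sum_mul]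
      refine Finset.sum_congr rfl fun k _ => ?_
      rw [Subfield.smul_def, smul_eq_mul, mul_assoc]
    have hzero := hu _ hrel kj.2
    have hzero' : ∑ k, ((a (k, kj.2) : F) : K) * ((b k : L) : K) = 0 := congrArg Subtype.val hzero
    -- `b` is `F`-free (inside `L`, hence inside `K`)
    have hbL : ∑ k, a (k, kj.2) • b k = 0 := by
      apply Subtype.ext
      simp only [AddSubmonoidClass.coe_finsetSum, IntermediateField.coe_smul, ZeroMemClass.coe_zero]
      rw [← hzero']
      refine Finset.sum_congr rfl fun k _ => ?_
      rw [Subfield.smul_def, smul_eq_mul]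
    exact Fintype.linearIndependent_iff.mp b.linearIndependent _ hbL kj.1
  -- hence so is `((b_k u_j)^p)`, and the relation `∑ g_jk (b_k u_j)^p = 0` kills every coordinate
  have hvp := H' _ _ hv
  have hrel2 : ∑ kj : Fin d × ↥(↑u : Set K),
      g kj.2 kj.1 • (((b kj.1 : L) : K) * (kj.2 : K)) ^ p = 0 := by
    rw [← hc, Fintype.sum_prod_type, Finset.sum_comm]
    refine Finset.sum_congr rfl fun j _ => ?_
    rw [Subfield.smul_def, smul_eq_mul, hg j, Finset.sum_mul]
    refine Finset.sum_congr rfl fun k _ => ?_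
    rw [Subfield.smul_def, smul_eq_mul, mul_pow, mul_assoc]
  have hg0 := Fintype.linearIndependent_iff.mp hvp _ hrel2
  intro j
  apply Subtype.ext
  rw [hg j, ZeroMemClass.coe_zero]
  refine Finset.sum_eq_zero fun k _ => ?_
  rw [show g j k = 0 from hg0 (k, j), ZeroMemClass.coe_zero, zero_mul]

/-! ## Separably generated over a perfect subfield ⇒ EFT-separably exhausted -/

omit [Fact p.Prime] [CharP K p] in
/-- **Finiteness of separability data**: if `x ∈ K` is separable algebraic over `P(B) = adjoin P B`, then the
minimal polynomial of `x` has its coefficients in `P(T)` for some finite `T ⊆ B`, so `x` is separable algebraic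
over the subfield `closure (P ∪ T')` for every `T' ⊇ T`. Stated for a finite set `s` of such elements at once.
[folklore] -/
theorem exists_finset_isSeparable_closure (P : Subfield K) (B : Set K) (s : Finset K)
    (hsep : ∀ x ∈ s, IsSeparable (IntermediateField.adjoin P B) x) :
    ∃ T : Finset K, (↑T : Set K) ⊆ B ∧ ∀ T' : Finset K, T ⊆ T' →
      ∀ x ∈ s, IsSeparable (Subfield.closure ((↑P : Set K) ∪ ↑T')) x := by
  classical
  set M : IntermediateField P K := IntermediateField.adjoin P B with hMdef
  -- finite supports of the coefficients of the minimal polynomials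
  have hcoef : ∀ (x : K) (i : ℕ), ∃ T : Finset K, (↑T : Set K) ⊆ B ∧
      (((minpoly M x).coeff i : M) : K) ∈ IntermediateField.adjoin P (↑T : Set K) :=
    fun x i => IntermediateField.exists_finset_of_mem_adjoin ((minpoly M x).coeff i).2
  choose Tc hTcB hTc using hcoef
  refine ⟨s.biUnion fun x => (Finset.range ((minpoly M x).natDegree + 1)).biUnion (Tc x), ?_, ?_⟩
  · intro y hy
    rw [Finset.mem_coe, Finset.mem_biUnion] at hy
    obtain ⟨x, -, hy⟩ := hy
    rw [Finset.mem_biUnion] at hy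
    obtain ⟨i, -, hy⟩ := hy
    exact hTcB x i hy
  · intro T' hTT' x hx
    set F₁ := Subfield.closure ((↑P : Set K) ∪ ↑T') with hF₁
    -- the minimal polynomial over `M`, read in `K[X]`, lifts to `F₁[X]`
    set g := (minpoly M x).map (algebraMap M K) with hgdef
    have hgcoeff : ∀ i, g.coeff i ∈ F₁ := by
      intro i
      rw [hgdef, Polynomial.coeff_map]
      by_cases hi : i ≤ (minpoly M x).natDegree
      · have hsub : (IntermediateField.adjoin P (↑(Tc x i) : Set K)).toSubfield ≤ F₁ := by
          rw [IntermediateField.adjoin_toSubfield, hF₁, Subfield.closure_le]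
          rintro y (⟨z, rfl⟩ | hy)
          · exact Subfield.subset_closure (Or.inl z.2)
          · refine Subfield.subset_closure (Or.inr (hTT' ?_))
            rw [Finset.mem_biUnion]
            refine ⟨x, hx, ?_⟩
            rw [Finset.mem_biUnion]
            exact ⟨i, Finset.mem_range.mpr (Nat.lt_succ_of_le hi), hy⟩
        exact hsub (hTc x i)
      · rw [Polynomial.coeff_eq_zero_of_natDegree_lt (not_le.mp hi), map_zero]
        exact zero_mem F₁
    have hlift : g ∈ Polynomial.lifts (algebraMap F₁ K) := by
      rw [Polynomial.lifts_iff_coeff_lifts]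
      intro i
      exact ⟨⟨g.coeff i, hgcoeff i⟩, rfl⟩
    obtain ⟨g', hg'⟩ := (Polynomial.mem_lifts g).mp hlift
    have hgsep : g.Separable := by
      rw [hgdef, Polynomial.separable_map]
      exact hsep x hx
    have hg'sep : g'.Separable := by
      rw [← Polynomial.separable_map (algebraMap F₁ K), hg']
      exact hgsep
    have hg'x : Polynomial.aeval x g' = 0 := by
      rw [← Polynomial.aeval_map_algebraMap K x g', hg', hgdef, Polynomial.aeval_map_algebraMap,
        minpoly.aeval]
    exact hg'sep.of_dvd (minpoly.dvd F₁ x hg'x)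

/-- **Separably generated over a perfect subfield ⇒ EFT-separably exhausted.** Let `P ≤ K` be perfect and `B ⊆ K`
a set all of whose finite subfamilies are `p`-independent in `K`, with `K` separable algebraic over `P(B)` (so `B`
is a separating transcendence basis of `K / P`, cf. `algebraicIndependent_of_pIndependent_perfect`). Then every
finite `s ⊆ K` lies in a subfield `E = P(T)(s)`, `T ⊆ B` finite, essentially of finite type over the perfect
field `P`, with `K / E` Mac Lane-separable: digits in `P(T)` (`linearIndepOn_pow_closure_perfect_range`) and the
separable step `P(T)(s) / P(T)` (`linearIndepOn_pow_of_isSeparable_tower`).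
[cite: Matsumura1987, §26 Thm. 26.5–26.8] -/
theorem exhaustedByEssFiniteType_of_separatingTranscendenceBasis (P : Subfield K)
    (hP : ∀ x ∈ P, ∃ y ∈ P, y ^ p = x) (B : Set K)
    (hB : ∀ (n : ℕ) (t : Fin n → K), Function.Injective t → Set.range t ⊆ B →
      ∀ e : (Fin n → Fin p) → K, ∑ α, (∏ i, t i ^ (α i : ℕ)) * e α ^ p = 0 → ∀ α, e α = 0)
    [Algebra.IsSeparable (IntermediateField.adjoin P B) K] (s : Finset K) :
    ∃ (k₀ : Type) (_ : Field k₀) (_ : PerfectField k₀) (E : Subfield K) (_ : Algebra k₀ E),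
      Algebra.EssFiniteType k₀ E ∧ (↑s : Set K) ⊆ E ∧
        ∀ u : Finset K, LinearIndepOn E _root_.id (↑u : Set K) →
          LinearIndepOn E (fun x : K => x ^ p) (↑u : Set K) := by
  classical
  haveI := perfectField_subfield_of_forall_exists_pow_eq p P hP
  -- a finite `T ⊆ B` over which `s` is separable algebraic
  obtain ⟨T, hTB, hTsep⟩ := exists_finset_isSeparable_closure P B s
    fun x _ => Algebra.IsSeparable.isSeparable _ x
  -- enumerate `T`
  set n := T.card with hn
  let t : Fin n → K := fun i => ((T.equivFin.symm i : ↥T) : K)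
  have htinj : Function.Injective t := fun a b h =>
    T.equivFin.symm.injective (Subtype.ext h)
  have htrange : Set.range t = ↑T := by
    ext y
    constructor
    · rintro ⟨i, rfl⟩
      exact (T.equivFin.symm i).2
    · intro hy
      exact ⟨T.equivFin ⟨y, hy⟩, by simp [t]⟩
  have ht := hB n t htinj (htrange ▸ hTB)
  -- the level `F₁ = P(T)` and Mac Lane for `K / F₁`
  set F₁ := Subfield.closure ((↑P : Set K) ∪ Set.range t) with hF₁
  have hML₁ := linearIndepOn_pow_closure_perfect_range P hP t ht
  have hsep₁ : ∀ x ∈ s, IsSeparable F₁ x := by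
    have h := hTsep T le_rfl
    rw [← htrange] at h
    exact h
  -- the level `E = F₁(s)`
  set E : Subfield K := (IntermediateField.adjoin F₁ (↑s : Set K)).toSubfield with hEdef
  have hF₁E : F₁ ≤ E := fun x hx =>
    (IntermediateField.adjoin F₁ (↑s : Set K)).algebraMap_mem ⟨x, hx⟩
  haveI : Algebra.IsSeparable F₁ (IntermediateField.adjoin F₁ (↑s : Set K)) :=
    (IntermediateField.isSeparable_adjoin_iff_isSeparable F₁ K).mpr fun x hx => hsep₁ x hx
  have hsepE : ∀ y ∈ E, IsSeparable F₁ y := fun y hy =>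
    IntermediateField.isSeparable_of_mem_isSeparable F₁ K (L := IntermediateField.adjoin F₁ (↑s : Set K)) hy
  have hMLE := linearIndepOn_pow_of_isSeparable_tower p F₁ E hF₁E hsepE hML₁
  -- `E` is essentially of finite type over `P`
  have hPE : P ≤ E := fun x hx => hF₁E (Subfield.subset_closure (Or.inl hx))
  letI : Algebra P E := (Subfield.inclusion hPE).toAlgebra
  haveI : IsScalarTower P E K := IsScalarTower.of_algebraMap_eq fun _ => rfl
  have hEeq : E = (IntermediateField.adjoin P (↑(T ∪ s) : Set K)).toSubfield := by
    rw [hEdef, IntermediateField.adjoin_toSubfield, IntermediateField.adjoin_toSubfield,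
      Finset.coe_union, ← htrange]
    have hr₁ : Set.range (algebraMap F₁ K) = (↑F₁ : Set K) := by
      ext y; exact ⟨fun ⟨z, hz⟩ => hz ▸ z.2, fun hy => ⟨⟨y, hy⟩, rfl⟩⟩
    have hrP : Set.range (algebraMap P K) = (↑P : Set K) := by
      ext y; exact ⟨fun ⟨z, hz⟩ => hz ▸ z.2, fun hy => ⟨⟨y, hy⟩, rfl⟩⟩
    rw [hr₁, hrP, Subfield.closure_union, Subfield.closure_eq, hF₁, ← Subfield.closure_union,
      Set.union_assoc]
  have hEFT : Algebra.EssFiniteType P E := essFiniteType_of_eq_adjoin_toSubfield P E (T ∪ s) hEeq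
  exact ⟨P, inferInstance, inferInstance, E, inferInstance, hEFT,
    fun x hx => IntermediateField.subset_adjoin F₁ _ hx, hMLE⟩

/-! ## The crux's conclusion over separably generated ground fields -/

/-- **Resolution over perfect fields ⇒ resolution over every ground field separably generated over a perfect
subfield** (reduced separated schemes of finite type of any dimension): such a field is EFT-separably exhausted
(`exhaustedByEssFiniteType_of_separatingTranscendenceBasis`), so the master class theorem
`hasResolution_of_perfectRes_of_exhaustedByEssFiniteType` applies. No bound on the transcendence degree.
[folklore] -/
theorem hasResolution_of_perfectRes_of_separatingTranscendenceBasis (p : ℕ) [Fact p.Prime]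
    (H : ∀ (κ : Type) [Field κ] [CharP κ p] [PerfectField κ] (Z : Scheme.{0}) (h : Z ⟶ Spec (.of κ)),
      IsSeparated h → LocallyOfFiniteType h → QuasiCompact h → IsReduced Z → Scheme.HasResolution Z)
    (K : Type) [Field K] [CharP K p] (P : Subfield K) (hP : ∀ x ∈ P, ∃ y ∈ P, y ^ p = x) (B : Set K)
    (hB : ∀ (n : ℕ) (t : Fin n → K), Function.Injective t → Set.range t ⊆ B →
      ∀ e : (Fin n → Fin p) → K, ∑ α, (∏ i, t i ^ (α i : ℕ)) * e α ^ p = 0 → ∀ α, e α = 0)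
    [Algebra.IsSeparable (IntermediateField.adjoin P B) K]
    (X : Scheme.{0}) (f : X ⟶ Spec (.of K)) [IsSeparated f] [LocallyOfFiniteType f] [QuasiCompact f]
    [IsReduced X] : Scheme.HasResolution X :=
  hasResolution_of_perfectRes_of_exhaustedByEssFiniteType p H K
    (exhaustedByEssFiniteType_of_separatingTranscendenceBasis P hP B hB) X f

/-- **The «separably generated over a perfect subfield» layer of the crux `DescentPerfectToAll`, proved**
(binder shape of stmt-0549 with the hypotheses "`P ≤ k` perfect", "`B ⊆ k` with `p`-independent finite
subfamilies" and "`k` separable algebraic over `P(B)`" inserted). [folklore] -/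
theorem descentPerfectToAll_separablyGeneratedPerfect :
    ∀ p : ℕ, p.Prime → (∀ (k : Type) [Field k] [CharP k p] [PerfectField k] (X : Scheme.{0})
      (f : X ⟶ Spec (.of k)), IsSeparated f → LocallyOfFiniteType f → QuasiCompact f →
        IsReduced X → Scheme.HasResolution X) →
    ∀ (k : Type) [Field k] [CharP k p] (P : Subfield k), (∀ x ∈ P, ∃ y ∈ P, y ^ p = x) →
      ∀ (B : Set k), (∀ (n : ℕ) (t : Fin n → k), Function.Injective t → Set.range t ⊆ B →
        ∀ e : (Fin n → Fin p) → k, ∑ α, (∏ i, t i ^ (α i : ℕ)) * e α ^ p = 0 → ∀ α, e α = 0) →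
      Algebra.IsSeparable (IntermediateField.adjoin P B) k →
      ∀ (X : Scheme.{0}) (f : X ⟶ Spec (.of k)),
        IsSeparated f → LocallyOfFiniteType f → QuasiCompact f → IsReduced X →
          Scheme.HasResolution X := by
  intro p hp H k _ _ P hP B hB hsep X f _ _ _ _
  haveI : Fact p.Prime := ⟨hp⟩
  haveI := hsep
  exact hasResolution_of_perfectRes_of_separatingTranscendenceBasis p
    (fun κ _ _ _ Z h a b c d => H κ Z h a b c d) k P hP B hB X f

end Summit.ResolutionOfSingularities.ResolutionOfSingularities.Theorems

end
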